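import Literature.ModelTheory.FiniteModelTheory.CountingLogic
import Literature.Combinatorics.SimpleGraph.HamiltonianCycleListings
import Literature.Computability.Complexity.HeldKarpSymmetricCircuit

/-!
# Hamiltonicity is `C^7`-invariant over the powerset expansion of a partially individualised
# graph: Held–Karp over subsets is a seven-variable counting-logic definition

Everything PROVED; no named facts. Setting (route PneNP/SymmetryBudget, "symmetry budget"): an
`m × m` Boolean matrix `x` is read as the simple graph `Gr m x = SimpleGraph.fromRel (x · · = true)`
on `Fin m`; at budget `g` the last `g` vertices (`IsFree m g i :↔ m ≤ i + g`) are FREE and the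
others ORDERED. The POWERSET EXPANSION `x⁺` of `x` (`PowCarrier m g x` with the structure
`powStructure`, relational language `powLang`) has as elements the vertices AND the sets of free
vertices (`FreeSets m g`, at most `2^g` of them), and the relations "is a vertex", the order of
the ordered part, adjacency, and membership `v ∈ S`. Its automorphisms over the input-independent
part are exactly the permutations of the free vertices.

Main theorem `PowersetHK.isHamiltonian_iff_of_structCkEquiv`: for every `m`, `g` and `k ≥ 7`,
if `x⁺ ≡^{C^k} y⁺` (the tree's bijective `k`-pebble game `StructCkEquiv powLang k`) then
`Gr m x` is Hamiltonian iff `Gr m y` is. No hypothesis on sizes, orbits or supports.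

Proof. The Held–Karp dynamic programme (Held–Karp 1962) over vertex sets `U = T ∪ S`, `T`
ordered, `S` free — "some duplicate-free path runs from `a` to `b` with vertex set exactly `U`"
(`HKSpec`, recursion `hkSpec_step` / `hkSpec_union_iff`) — is written as a family of formulas
`phi μ T β σ` of the tree's `k`-variable counting logic `CFormula powLang 7` (`CountingLogic.lean`):
the ordered part `T` of the vertex set is carried in the INDEX of the formula (ordered vertices
are definable constants: `ordPin t`, "exactly `t` predecessors", two counting quantifiers), the
free part is a set-sort VARIABLE, and the seven variables `A, B₀, B₁, S₀, S₁, V, W` are re-used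
along the recursion (end vertex alternating between `B₀/B₁`, free set between `S₀/S₁`, `V` for set
extensionality, `W` for counting and set witnesses). `realize_phi` proves that the formulas define
the Held–Karp table (induction on the fuel `μ ≥ |T| + |S| - 1`); `hamSentence` /
`realize_hamSentence` express Hamiltonicity (`m ≥ 3`, via `isHamiltonian_iff_of_three_le_card`);
the transfer along the game is Hella's theorem, game ⇒ logic
(`PebbleStrategySpace.realize_iff_of_ofFun_mem`); `m ≤ 2` is edge-independent.

Why it is here (consumers). Crux `WindowHam` of route PneNP/SymmetryBudget (stmt-PneNP-2143) and
its sibling `HamCompiles` (stmt-PneNP-10637): this is the definability half ("step (1)", the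
ideators' stub `stub_ham_invariant_powersetCk`, with `k₀ = 7`) of the powerset Held–Karp collapse
`NP ⊆ P/poly ⇒ ¬WindowHam`; unconditionally it shows that NO PAIR OF INPUTS WITH `C^7`-EQUIVALENT
POWERSET EXPANSIONS IS SEPARATED BY HAMILTONICITY, so fooling-pair / pebble-game lower-bound
arguments played on `x⁺` are void for Hamiltonicity at every budget. Nearest printed precedents:
Cai–Fürer–Immerman 1992 (the logics `C^k` and the game), Dawar–Richerby–Rossman 2008 and
Blass–Gurevich–Shelah 1999 (choiceless computation has all subsets of a set `S` available once
`2^|S|` is polynomial — the uniform shadow of the set sort used here).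

Not here: `k`-dimensional Weisfeiler–Leman on `x⁺` as a symmetric circuit and its completeness for
`≡^{C^k}` (the other half of the collapse); optimality of `7`.

## References

* M. Held, R. M. Karp, *A dynamic programming approach to sequencing problems*, J. SIAM 10 (1962)
  196–210.
* J.-Y. Cai, M. Fürer, N. Immerman, *An optimal lower bound on the number of variables for graph
  identification*, Combinatorica 12 (1992), §4–§5.
* L. Hella, *Logical hierarchies in PTIME*, Inform. and Comput. 129 (1996) 1–19.
* A. Blass, Y. Gurevich, S. Shelah, *Choiceless polynomial time*, Ann. Pure Appl. Logic 100 (1999).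
* A. Dawar, D. Richerby, B. Rossman, *Choiceless polynomial time, counting and the
  Cai–Fürer–Immerman graphs*, Ann. Pure Appl. Logic 152 (2008).
-/


namespace Literature.ModelTheory.FiniteModelTheory.PowersetHK

open FirstOrder Finset Literature.Computability.Complexity.HeldKarp

/-! ## §A The powerset expansion of a matrix input at budget `g` -/

/-- Relation symbols of the powerset language: "is a vertex", the order of the ordered part,
adjacency, and membership of a vertex in a set of free vertices. [folklore] -/
inductive PowRel : ℕ → Type
  | vert : PowRel 1
  | lt : PowRel 2
  | edge : PowRel 2
  | mem : PowRel 2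

/-- The (relational) powerset language. [folklore] -/
def powLang : FirstOrder.Language.{0, 0} := ⟨fun _ => PEmpty.{1}, PowRel⟩

/-- Vertex `i` is FREE at budget `g`: one of the last `g` vertices (`m ≤ i + g`); the others
(`i + g < m`) are ORDERED. [folklore] -/
def IsFree (m g : ℕ) (i : Fin m) : Prop := m ≤ (i : ℕ) + g

/-- Freeness is decidable. [folklore] -/
instance (m g : ℕ) : DecidablePred (IsFree m g) := fun i => by unfold IsFree; infer_instance

/-- The sets of free vertices (the second sort of the powerset expansion). [folklore] -/
abbrev FreeSets (m g : ℕ) : Type := {S : Finset (Fin m) // ∀ i ∈ S, IsFree m g i}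

/-- Carrier of the powerset expansion of the input `x` at budget `g`: the vertices together with
the sets of free vertices (the carrier does not depend on `x`; the parameter keys the structure
instance, so this is deliberately a `def`, not an `abbrev`). [folklore] -/
def PowCarrier (m g : ℕ) (_x : Fin m × Fin m → Bool) : Type := Fin m ⊕ FreeSets m g

section Carrier

variable {m g : ℕ} {x : Fin m × Fin m → Bool}

/-- A vertex as an element of the expansion. [folklore] -/
def vtx (u : Fin m) : PowCarrier m g x := Sum.inl u

/-- A set of free vertices as an element of the expansion. [folklore] -/
def fset (S : FreeSets m g) : PowCarrier m g x := Sum.inr S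

/-- `vtx` is injective. [folklore] -/
@[simp] theorem vtx_inj {u u' : Fin m} : (vtx u : PowCarrier m g x) = vtx u' ↔ u = u' :=
  ⟨fun h => Sum.inl_injective h, fun h => h ▸ rfl⟩

/-- `fset` is injective. [folklore] -/
@[simp] theorem fset_inj {S S' : FreeSets m g} : (fset S : PowCarrier m g x) = fset S' ↔ S = S' :=
  ⟨fun h => Sum.inr_injective h, fun h => h ▸ rfl⟩

/-- Vertices are not sets. [folklore] -/
@[simp] theorem vtx_ne_fset {u : Fin m} {S : FreeSets m g} : (vtx u : PowCarrier m g x) ≠ fset S :=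
  Sum.inl_ne_inr

/-- Sets are not vertices. [folklore] -/
@[simp] theorem fset_ne_vtx {u : Fin m} {S : FreeSets m g} : (fset S : PowCarrier m g x) ≠ vtx u :=
  Sum.inr_ne_inl

/-- Every element of the expansion is a vertex or a set. [folklore] -/
theorem vtx_or_fset (z : PowCarrier m g x) : (∃ u, z = vtx u) ∨ ∃ S, z = fset S := by
  rcases z with u | S
  · exact Or.inl ⟨u, rfl⟩
  · exact Or.inr ⟨S, rfl⟩

/-- The vertex embedding. [folklore] -/
def vtxEmb : Fin m ↪ PowCarrier m g x := ⟨vtx, fun _ _ h => vtx_inj.1 h⟩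

/-- The vertex embedding is `vtx`. [folklore] -/
@[simp] theorem vtxEmb_apply (u : Fin m) : (vtxEmb u : PowCarrier m g x) = vtx u := rfl

/-- The expansion always contains the empty set. [folklore] -/
instance : Nonempty (PowCarrier m g x) := ⟨fset ⟨∅, fun _ h => absurd h (Finset.notMem_empty _)⟩⟩

/-- The expansion is finite (`m + 2^{#free}` elements at most). [folklore] -/
noncomputable instance : Fintype (PowCarrier m g x) := inferInstanceAs (Fintype (Fin m ⊕ FreeSets m g))

end Carrier

/-- The simple graph decoded from an `m × m` Boolean matrix (symmetrised, loops dropped). [folklore] -/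
abbrev Gr (m : ℕ) (x : Fin m × Fin m → Bool) : SimpleGraph (Fin m) :=
  SimpleGraph.fromRel fun u v => x (u, v) = true

/-- Interpretation of the relation symbols on the powerset expansion of `x`. [folklore] -/
def powRelMap (m g : ℕ) (x : Fin m × Fin m → Bool) :
    ∀ {n : ℕ}, PowRel n → (Fin n → PowCarrier m g x) → Prop
  | _, .vert, v => ∃ u : Fin m, v 0 = vtx u
  | _, .lt, v => ∃ u w : Fin m, v 0 = vtx u ∧ v 1 = vtx w ∧
      (u : ℕ) + g < m ∧ (w : ℕ) + g < m ∧ u < w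
  | _, .edge, v => ∃ u w : Fin m, v 0 = vtx u ∧ v 1 = vtx w ∧ (Gr m x).Adj u w
  | _, .mem, v => ∃ (u : Fin m) (S : FreeSets m g), v 0 = vtx u ∧ v 1 = fset S ∧ u ∈ S.1

/-- The powerset expansion `x⁺` of `x` at budget `g` as a `powLang`-structure. [folklore] -/
instance powStructure (m g : ℕ) (x : Fin m × Fin m → Bool) :
    powLang.Structure (PowCarrier m g x) where
  funMap := fun f _ => (f : PEmpty).elim
  RelMap := fun R v => powRelMap m g x R v

/-! ## §B `C^7` formulas: variables, atoms, quantifiers -/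

section Formulas

variable {m g : ℕ} {x : Fin m × Fin m → Bool}

/-- Variable of the start vertex `a`. [folklore] -/
def iA : Fin 7 := 0
/-- The two alternating variables for the end vertex `b`. [folklore] -/
def iB (β : Fin 2) : Fin 7 := ⟨1 + β, by omega⟩
/-- The two alternating variables for the free vertex set `S`. [folklore] -/
def iS (σ : Fin 2) : Fin 7 := ⟨3 + σ, by omega⟩
/-- Scratch vertex variable (set extensionality). [folklore] -/
def iV : Fin 7 := 5
/-- Scratch variable for counting and set witnesses. [folklore] -/
def iW : Fin 7 := 6

/-- Distinctness of the variables. [folklore] -/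
theorem iA_ne_iB (β : Fin 2) : iA ≠ iB β := by fin_cases β <;> decide
/-- Distinctness of the variables. [folklore] -/
theorem iA_ne_iS (σ : Fin 2) : iA ≠ iS σ := by fin_cases σ <;> decide
/-- Distinctness of the variables. [folklore] -/
theorem iB_ne_iS (β σ : Fin 2) : iB β ≠ iS σ := by fin_cases β <;> fin_cases σ <;> decide
/-- Distinctness of the variables. [folklore] -/
theorem iB_rev_ne (β : Fin 2) : iB β.rev ≠ iB β := by fin_cases β <;> decide
/-- Distinctness of the variables. [folklore] -/
theorem iS_rev_ne (σ : Fin 2) : iS σ.rev ≠ iS σ := by fin_cases σ <;> decide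
/-- Distinctness of the variables. [folklore] -/
theorem iV_ne_iA : iV ≠ iA := by decide
/-- Distinctness of the variables. [folklore] -/
theorem iV_ne_iB (β : Fin 2) : iV ≠ iB β := by fin_cases β <;> decide
/-- Distinctness of the variables. [folklore] -/
theorem iV_ne_iS (σ : Fin 2) : iV ≠ iS σ := by fin_cases σ <;> decide
/-- Distinctness of the variables. [folklore] -/
theorem iW_ne_iA : iW ≠ iA := by decide
/-- Distinctness of the variables. [folklore] -/
theorem iW_ne_iB (β : Fin 2) : iW ≠ iB β := by fin_cases β <;> decide
/-- Distinctness of the variables. [folklore] -/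
theorem iW_ne_iS (σ : Fin 2) : iW ≠ iS σ := by fin_cases σ <;> decide
/-- Distinctness of the variables. [folklore] -/
theorem iW_ne_iV : iW ≠ iV := by decide
/-- Distinctness of the variables. [folklore] -/
theorem iS_ne_iV (σ : Fin 2) : iS σ ≠ iV := (iV_ne_iS σ).symm
/-- Distinctness of the variables. [folklore] -/
theorem iB_ne_iV (β : Fin 2) : iB β ≠ iV := (iV_ne_iB β).symm
/-- Distinctness of the variables. [folklore] -/
theorem iA_ne_iV : iA ≠ iV := iV_ne_iA.symm

/-- `vert(xᵢ)`. [folklore] -/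
def vertF (i : Fin 7) : CFormula powLang 7 := .rel PowRel.vert ![i]
/-- `lt(xᵢ, xⱼ)`. [folklore] -/
def ltF (i j : Fin 7) : CFormula powLang 7 := .rel PowRel.lt ![i, j]
/-- `E(xᵢ, xⱼ)`. [folklore] -/
def edgeF (i j : Fin 7) : CFormula powLang 7 := .rel PowRel.edge ![i, j]
/-- `xᵢ ∈ xⱼ`. [folklore] -/
def memF (i j : Fin 7) : CFormula powLang 7 := .rel PowRel.mem ![i, j]
/-- `∃ xᵢ φ` (`= ∃^{≥1}`). [folklore] -/
def exF (i : Fin 7) (φ : CFormula powLang 7) : CFormula powLang 7 := .existsGE 1 i φ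
/-- `∀ xᵢ φ`. [folklore] -/
def allF (i : Fin 7) (φ : CFormula powLang 7) : CFormula powLang 7 := .not (exF i (.not φ))
/-- `φ → ψ`. [folklore] -/
def impF (φ ψ : CFormula powLang 7) : CFormula powLang 7 := .not (.and φ (.not ψ))
/-- `φ ↔ ψ`. [folklore] -/
def iffF (φ ψ : CFormula powLang 7) : CFormula powLang 7 := .and (impF φ ψ) (impF ψ φ)

variable (v : Fin 7 → PowCarrier m g x)

/-- Semantics of `vert`. [folklore] -/
theorem realize_vertF (i : Fin 7) : (vertF i).Realize v ↔ ∃ u : Fin m, v i = vtx u := by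
  show (∃ u : Fin m, (v ∘ ![i]) 0 = vtx u) ↔ _
  simp

/-- Semantics of `lt`. [folklore] -/
theorem realize_ltF (i j : Fin 7) : (ltF i j).Realize v ↔ ∃ u w : Fin m,
    v i = vtx u ∧ v j = vtx w ∧ (u : ℕ) + g < m ∧ (w : ℕ) + g < m ∧ u < w := by
  show (∃ u w : Fin m, (v ∘ ![i, j]) 0 = vtx u ∧ (v ∘ ![i, j]) 1 = vtx w ∧ _) ↔ _
  simp

/-- Semantics of `E`. [folklore] -/
theorem realize_edgeF (i j : Fin 7) : (edgeF i j).Realize v ↔ ∃ u w : Fin m,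
    v i = vtx u ∧ v j = vtx w ∧ (Gr m x).Adj u w := by
  show (∃ u w : Fin m, (v ∘ ![i, j]) 0 = vtx u ∧ (v ∘ ![i, j]) 1 = vtx w ∧ _) ↔ _
  simp

/-- Semantics of `∈`. [folklore] -/
theorem realize_memF (i j : Fin 7) : (memF i j).Realize v ↔ ∃ (u : Fin m) (S : FreeSets m g),
    v i = vtx u ∧ v j = fset S ∧ u ∈ S.1 := by
  show (∃ (u : Fin m) (S : FreeSets m g),
    (v ∘ ![i, j]) 0 = vtx u ∧ (v ∘ ![i, j]) 1 = fset S ∧ _) ↔ _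
  simp

/-- Semantics of the counting quantifier. [folklore] -/
theorem realize_existsGE (n : ℕ) (i : Fin 7) (φ : CFormula powLang 7) :
    (CFormula.existsGE n i φ).Realize v ↔
      (n : ℕ∞) ≤ {z : PowCarrier m g x | φ.Realize (Function.update v i z)}.encard := Iff.rfl

/-- Semantics of `∃`. [folklore] -/
theorem realize_exF (i : Fin 7) (φ : CFormula powLang 7) :
    (exF i φ).Realize v ↔ ∃ z, φ.Realize (Function.update v i z) := by
  show (((1 : ℕ) : ℕ∞) ≤ {z : PowCarrier m g x | φ.Realize (Function.update v i z)}.encard) ↔ _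
  rw [Nat.cast_one, Set.one_le_encard_iff_nonempty]
  rfl

/-- Semantics of `∀`. [folklore] -/
theorem realize_allF (i : Fin 7) (φ : CFormula powLang 7) :
    (allF i φ).Realize v ↔ ∀ z, φ.Realize (Function.update v i z) := by
  show (¬ (exF i (.not φ)).Realize v) ↔ _
  rw [realize_exF]
  show (¬ ∃ z, ¬ φ.Realize (Function.update v i z)) ↔ _
  push Not
  rfl

/-- Semantics of `¬`. [folklore] -/
theorem realize_not (φ : CFormula powLang 7) : (CFormula.not φ).Realize v ↔ ¬ φ.Realize v := Iff.rfl

/-- Semantics of `∧`. [folklore] -/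
theorem realize_and (φ ψ : CFormula powLang 7) :
    (CFormula.and φ ψ).Realize v ↔ φ.Realize v ∧ ψ.Realize v := Iff.rfl

/-- Semantics of `=`. [folklore] -/
theorem realize_equal (i j : Fin 7) :
    (CFormula.equal (L := powLang) i j).Realize v ↔ v i = v j := Iff.rfl

/-- Semantics of `⊥`. [folklore] -/
theorem realize_falsum : (CFormula.falsum (L := powLang) (k := 7)).Realize v ↔ False := Iff.rfl

/-- Semantics of `→`. [folklore] -/
theorem realize_impF (φ ψ : CFormula powLang 7) :
    (impF φ ψ).Realize v ↔ (φ.Realize v → ψ.Realize v) := by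
  show (¬ (φ.Realize v ∧ ¬ ψ.Realize v)) ↔ _
  tauto

/-- Semantics of `↔`. [folklore] -/
theorem realize_iffF (φ ψ : CFormula powLang 7) :
    (iffF φ ψ).Realize v ↔ (φ.Realize v ↔ ψ.Realize v) := by
  show ((impF φ ψ).Realize v ∧ (impF ψ φ).Realize v) ↔ _
  rw [realize_impF, realize_impF]
  tauto

/-! ### Ordered vertices are definable constants (counting their predecessors) -/

/-- `xᵢ` is an ORDERED vertex: a vertex belonging to no set of the expansion. [folklore] -/
def isOrdF (i : Fin 7) : CFormula powLang 7 := .and (vertF i) (.not (exF iW (memF i iW)))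

/-- A vertex belongs to some set of the expansion iff it is free. [folklore] -/
theorem realize_exF_memF {i : Fin 7} (hi : iW ≠ i) :
    (exF iW (memF i iW)).Realize v ↔ ∃ u : Fin m, v i = vtx u ∧ IsFree m g u := by
  rw [realize_exF]
  constructor
  · rintro ⟨z, hz⟩
    rw [realize_memF] at hz
    obtain ⟨u, S, hu, -, hmem⟩ := hz
    rw [Function.update_of_ne hi.symm] at hu
    exact ⟨u, hu, S.2 u hmem⟩
  · rintro ⟨u, hu, hfree⟩
    refine ⟨fset ⟨{u}, by simpa using hfree⟩, ?_⟩
    rw [realize_memF]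
    refine ⟨u, ⟨{u}, by simpa using hfree⟩, ?_, ?_, by simp⟩
    · rw [Function.update_of_ne hi.symm, hu]
    · rw [Function.update_self]

/-- Semantics of `isOrdF`. [folklore] -/
theorem realize_isOrdF {i : Fin 7} (hi : iW ≠ i) :
    (isOrdF i).Realize v ↔ ∃ u : Fin m, v i = vtx u ∧ (u : ℕ) + g < m := by
  show ((vertF i).Realize v ∧ ¬ (exF iW (memF i iW)).Realize v) ↔ _
  rw [realize_vertF, realize_exF_memF v hi]
  constructor
  · rintro ⟨⟨u, hu⟩, hno⟩
    refine ⟨u, hu, ?_⟩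
    by_contra hlt
    exact hno ⟨u, hu, by unfold IsFree; omega⟩
  · rintro ⟨u, hu, hord⟩
    refine ⟨⟨u, hu⟩, ?_⟩
    rintro ⟨u', hu', hfree⟩
    rw [hu, vtx_inj] at hu'
    subst hu'
    unfold IsFree at hfree
    omega

/-- The predecessors of an ordered vertex `w` in the expansion are the `w` smaller vertices. [folklore] -/
theorem encard_lt_set {i : Fin 7} (hi : iW ≠ i) {w : Fin m} (hvi : v i = vtx w)
    (hw : (w : ℕ) + g < m) :
    {z : PowCarrier m g x | (ltF iW i).Realize (Function.update v iW z)}.encard = (w : ℕ) := by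
  have hset : {z : PowCarrier m g x | (ltF iW i).Realize (Function.update v iW z)} =
      vtxEmb '' (↑(Finset.Iio w) : Set (Fin m)) := by
    ext z
    simp only [Set.mem_setOf_eq, realize_ltF, Function.update_self,
      Function.update_of_ne hi.symm, hvi, Set.mem_image, Finset.coe_Iio, Set.mem_Iio, vtxEmb_apply,
      vtx_inj]
    constructor
    · rintro ⟨u, w', rfl, hw', -, -, huw⟩
      subst hw'
      exact ⟨u, huw, rfl⟩
    · rintro ⟨u, huw, rfl⟩
      have h1 : (u : ℕ) < w := huw
      exact ⟨u, w, rfl, rfl, by omega, hw, huw⟩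
  rw [hset, vtxEmb.injective.encard_image, Set.encard_coe_eq_coe_finsetCard, Fin.card_Iio]

/-- `ordPin t i`: "`xᵢ` is the ordered vertex with exactly `t` predecessors", i.e. `xᵢ = t`.
[folklore] -/
def ordPin (t : ℕ) (i : Fin 7) : CFormula powLang 7 :=
  .and (isOrdF i) (.and (.existsGE t iW (ltF iW i)) (.not (.existsGE (t + 1) iW (ltF iW i))))

/-- Semantics of `ordPin`: it pins `xᵢ` to the ordered vertex number `t`. [folklore] -/
theorem realize_ordPin {i : Fin 7} (hi : iW ≠ i) (t : Fin m) (ht : (t : ℕ) + g < m) :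
    (ordPin t i).Realize v ↔ v i = vtx t := by
  show ((isOrdF i).Realize v ∧ (CFormula.existsGE (t : ℕ) iW (ltF iW i)).Realize v ∧
    ¬ (CFormula.existsGE ((t : ℕ) + 1) iW (ltF iW i)).Realize v) ↔ _
  rw [realize_isOrdF v hi, realize_existsGE, realize_existsGE]
  constructor
  · rintro ⟨⟨u, hu, hord⟩, hge, hlt⟩
    rw [encard_lt_set v hi hu hord] at hge hlt
    rw [hu, vtx_inj]
    apply Fin.ext
    have h1 : (t : ℕ) ≤ u := by exact_mod_cast hge
    have h2 : ¬ ((t : ℕ) + 1 ≤ u) := fun h => hlt (by exact_mod_cast h)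
    omega
  · intro hvi
    refine ⟨⟨t, hvi, ht⟩, ?_, ?_⟩
    · rw [encard_lt_set v hi hvi ht]
    · rw [encard_lt_set v hi hvi ht]
      exact fun h => by
        have : (t : ℕ) + 1 ≤ t := by exact_mod_cast h
        omega

/-! ### Membership in `T ∪ S`, set difference, and the base cases -/

/-- `xᵢ ∈ T` for a set `T` of ordered vertices (a disjunction of pins). [folklore] -/
def inT (T : Finset (Fin m)) (i : Fin 7) : CFormula powLang 7 :=
  CFormula.disj ((T.sort (· ≤ ·)).map fun t : Fin m => ordPin (t : ℕ) i)

/-- Semantics of `inT`. [folklore] -/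
theorem realize_inT {i : Fin 7} (hi : iW ≠ i) (T : Finset (Fin m))
    (hT : ∀ t ∈ T, (t : ℕ) + g < m) : (inT T i).Realize v ↔ ∃ t ∈ T, v i = vtx t := by
  unfold inT
  rw [CFormula.realize_disj]
  simp only [List.mem_map, Finset.mem_sort]
  constructor
  · rintro ⟨φ, ⟨t, ht, rfl⟩, hφ⟩
    exact ⟨t, ht, (realize_ordPin v hi t (hT t ht)).1 hφ⟩
  · rintro ⟨t, ht, hvt⟩
    exact ⟨_, ⟨t, ht, rfl⟩, (realize_ordPin v hi t (hT t ht)).2 hvt⟩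

/-- `xᵢ ∈ T ∪ S_σ`. [folklore] -/
def inU (T : Finset (Fin m)) (σ : Fin 2) (i : Fin 7) : CFormula powLang 7 :=
  (inT T i).or (memF i (iS σ))

/-- Semantics of `inU`. [folklore] -/
theorem realize_inU {i : Fin 7} (hi : iW ≠ i) (T : Finset (Fin m)) (hT : ∀ t ∈ T, (t : ℕ) + g < m)
    (σ : Fin 2) (S : FreeSets m g) (hS : v (iS σ) = fset S) :
    (inU T σ i).Realize v ↔ ∃ u, v i = vtx u ∧ u ∈ T ∪ S.1 := by
  unfold inU
  rw [CFormula.realize_or, realize_inT v hi T hT, realize_memF]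
  constructor
  · rintro (⟨t, ht, hvt⟩ | ⟨u, S', hu, hS', hmem⟩)
    · exact ⟨t, hvt, Finset.mem_union_left _ ht⟩
    · rw [hS, fset_inj] at hS'
      subst hS'
      exact ⟨u, hu, Finset.mem_union_right _ hmem⟩
  · rintro ⟨u, hu, hmem⟩
    rcases Finset.mem_union.1 hmem with h | h
    · exact Or.inl ⟨u, h, hu⟩
    · exact Or.inr ⟨u, S, hu, hS, h⟩

/-- The membership atom at a vertex value and a known set value. [folklore] -/
theorem exists_vtx_fset_iff {z w : PowCarrier m g x} (S : FreeSets m g) (hw : w = fset S) :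
    (∃ (u : Fin m) (S' : FreeSets m g), z = vtx u ∧ w = fset S' ∧ u ∈ S'.1) ↔
      ∃ u, z = vtx u ∧ u ∈ S.1 := by
  subst hw
  constructor
  · rintro ⟨u, S', hz, hS', hmem⟩
    rw [fset_inj] at hS'
    subst hS'
    exact ⟨u, hz, hmem⟩
  · rintro ⟨u, hz, hmem⟩
    exact ⟨u, S, hz, rfl, hmem⟩

/-- `S_{σ'} = S_σ ∖ {B_β}` (set sort, extensionally). [folklore] -/
def isDiffF (σ' σ β : Fin 2) : CFormula powLang 7 :=
  .and (.not (vertF (iS σ')))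
    (allF iV (iffF (memF iV (iS σ')) (.and (memF iV (iS σ)) (.not (.equal iV (iB β))))))

/-- Semantics of `isDiffF`. [folklore] -/
theorem realize_isDiffF (σ' σ β : Fin 2) (S : FreeSets m g) (b : Fin m)
    (hS : v (iS σ) = fset S) (hb : v (iB β) = vtx b) :
    (isDiffF σ' σ β).Realize v ↔ ∃ S' : FreeSets m g, v (iS σ') = fset S' ∧ S'.1 = S.1.erase b := by
  show (¬ (vertF (iS σ')).Realize v ∧ (allF iV (iffF (memF iV (iS σ')) (.and (memF iV (iS σ))
    (.not (.equal iV (iB β)))))).Realize v) ↔ _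
  rw [realize_vertF, realize_allF]
  have inner : ∀ z : PowCarrier m g x, (iffF (memF iV (iS σ')) (.and (memF iV (iS σ))
      (.not (.equal iV (iB β))))).Realize (Function.update v iV z) ↔
      ((∃ (u : Fin m) (S' : FreeSets m g), z = vtx u ∧ v (iS σ') = fset S' ∧ u ∈ S'.1) ↔
        ((∃ u, z = vtx u ∧ u ∈ S.1) ∧ z ≠ vtx b)) := by
    intro z
    rw [realize_iffF, realize_and, realize_not, realize_equal, realize_memF, realize_memF]
    simp only [Function.update_self, Function.update_of_ne (iS_ne_iV _),
      Function.update_of_ne (iB_ne_iV _), hb]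
    rw [exists_vtx_fset_iff S hS]
  simp only [inner]
  constructor
  · rintro ⟨hnv, hall⟩
    rcases vtx_or_fset (v (iS σ')) with ⟨u, hu⟩ | ⟨S', hS'⟩
    · exact absurd ⟨u, hu⟩ hnv
    refine ⟨S', hS', ?_⟩
    ext u
    have hu := hall (vtx u)
    rw [exists_vtx_fset_iff S' hS'] at hu
    simp only [vtx_inj, exists_eq_left', ne_eq, Finset.mem_erase] at hu ⊢
    tauto
  · rintro ⟨S', hS', hdiff⟩
    refine ⟨fun ⟨u, hu⟩ => absurd (hS'.symm.trans hu) fset_ne_vtx, fun z => ?_⟩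
    rw [exists_vtx_fset_iff S' hS']
    rcases vtx_or_fset z with ⟨u, rfl⟩ | ⟨S'', rfl⟩
    · simp only [vtx_inj, exists_eq_left', ne_eq, hdiff, Finset.mem_erase]
      tauto
    · simp

/-- `S_σ = {A}`. [folklore] -/
def setIsSingletonA (σ : Fin 2) : CFormula powLang 7 :=
  .and (memF iA (iS σ)) (allF iV (impF (memF iV (iS σ)) (.equal iV iA)))

/-- Semantics of `setIsSingletonA`. [folklore] -/
theorem realize_setIsSingletonA (σ : Fin 2) (S : FreeSets m g) (a : Fin m)
    (hS : v (iS σ) = fset S) (ha : v iA = vtx a) :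
    (setIsSingletonA σ).Realize v ↔ S.1 = {a} := by
  show ((memF iA (iS σ)).Realize v ∧ (allF iV (impF (memF iV (iS σ)) (.equal iV iA))).Realize v) ↔ _
  rw [realize_memF, exists_vtx_fset_iff S hS, realize_allF]
  have inner : ∀ z : PowCarrier m g x, (impF (memF iV (iS σ)) (.equal iV iA)).Realize
      (Function.update v iV z) ↔ ((∃ u, z = vtx u ∧ u ∈ S.1) → z = vtx a) := by
    intro z
    rw [realize_impF, realize_equal, realize_memF]
    simp only [Function.update_self, Function.update_of_ne (iS_ne_iV _),
      Function.update_of_ne iA_ne_iV, ha]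
    rw [exists_vtx_fset_iff S hS]
  simp only [inner]
  rw [ha]
  constructor
  · rintro ⟨⟨a', ha', haS⟩, hall⟩
    rw [vtx_inj] at ha'
    subst ha'
    exact Finset.eq_singleton_iff_unique_mem.2
      ⟨haS, fun u hu => vtx_inj.1 (hall (vtx u) ⟨u, rfl, hu⟩)⟩
  · intro hSa
    refine ⟨⟨a, rfl, by simp [hSa]⟩, ?_⟩
    rintro z ⟨u, rfl, hu⟩
    rw [hSa, Finset.mem_singleton] at hu
    rw [hu]

/-- `S_σ = ∅`. [folklore] -/
def setEmpty (σ : Fin 2) : CFormula powLang 7 := allF iV (.not (memF iV (iS σ)))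

/-- Semantics of `setEmpty`. [folklore] -/
theorem realize_setEmpty (σ : Fin 2) (S : FreeSets m g) (hS : v (iS σ) = fset S) :
    (setEmpty σ).Realize v ↔ S.1 = ∅ := by
  unfold setEmpty
  rw [realize_allF]
  have inner : ∀ z : PowCarrier m g x, (CFormula.not (memF iV (iS σ))).Realize (Function.update v iV z) ↔
      ¬ ∃ u, z = vtx u ∧ u ∈ S.1 := by
    intro z
    rw [realize_not, realize_memF]
    simp only [Function.update_self, Function.update_of_ne (iS_ne_iV _)]
    rw [exists_vtx_fset_iff S hS]
  simp only [inner]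
  constructor
  · intro h
    exact Finset.eq_empty_of_forall_notMem fun u hu => h (vtx u) ⟨u, rfl, hu⟩
  · rintro hS0 z ⟨u, -, hu⟩
    simp [hS0] at hu

/-- The base of the recursion: `T ∪ S_σ = {A}` and `B_β = A`. [folklore] -/
def base (T : Finset (Fin m)) (β σ : Fin 2) : CFormula powLang 7 :=
  .and (.equal (iB β) iA)
    (if T = ∅ then setIsSingletonA σ
     else CFormula.disj ((T.sort (· ≤ ·)).map fun t : Fin m =>
       if T = {t} then .and (setEmpty σ) (ordPin (t : ℕ) iA) else .falsum))

/-- Ordered and free vertices are distinct. [folklore] -/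
theorem not_mem_of_ordered {T : Finset (Fin m)} (hT : ∀ t ∈ T, (t : ℕ) + g < m) (S : FreeSets m g)
    {u : Fin m} (hu : u ∈ S.1) : u ∉ T := fun huT => by
  have h1 := hT u huT
  have h2 := S.2 u hu
  unfold IsFree at h2
  omega

/-- Semantics of the base. [folklore] -/
theorem realize_base (T : Finset (Fin m)) (hT : ∀ t ∈ T, (t : ℕ) + g < m) (β σ : Fin 2)
    (S : FreeSets m g) (a b : Fin m) (ha : v iA = vtx a) (hb : v (iB β) = vtx b)
    (hS : v (iS σ) = fset S) :
    (base T β σ).Realize v ↔ (b = a ∧ T ∪ S.1 = {a}) := by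
  unfold base
  rw [realize_and, realize_equal, hb, ha, vtx_inj]
  refine and_congr_right fun _ => ?_
  split_ifs with hT0
  · subst hT0
    rw [realize_setIsSingletonA v σ S a hS ha, Finset.empty_union]
  · rw [CFormula.realize_disj]
    simp only [List.mem_map, Finset.mem_sort]
    constructor
    · rintro ⟨φ, ⟨t, ht, rfl⟩, hφ⟩
      split_ifs at hφ with hTt
      · rw [realize_and, realize_setEmpty v σ S hS, realize_ordPin v iW_ne_iA t (hT t ht), ha,
          vtx_inj] at hφ
        rw [hTt, hφ.1, Finset.union_empty, hφ.2]
      · exact hφ.elim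
    · intro hU
      have hTa : T = {a} := by
        refine Finset.eq_singleton_iff_unique_mem.2 ⟨?_, fun t ht => ?_⟩
        · obtain ⟨t, ht⟩ := Finset.nonempty_iff_ne_empty.2 hT0
          have : t ∈ T ∪ S.1 := Finset.mem_union_left _ ht
          rw [hU, Finset.mem_singleton] at this
          exact this ▸ ht
        · have : t ∈ T ∪ S.1 := Finset.mem_union_left _ ht
          rw [hU, Finset.mem_singleton] at this
          exact this
      have hS0 : S.1 = ∅ := by
        refine Finset.eq_empty_of_forall_notMem fun u hu => ?_
        have : u ∈ T ∪ S.1 := Finset.mem_union_right _ hu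
        rw [hU, Finset.mem_singleton] at this
        subst this
        exact not_mem_of_ordered hT S hu (hTa ▸ Finset.mem_singleton_self _)
      refine ⟨_, ⟨a, hTa ▸ Finset.mem_singleton_self a, rfl⟩, ?_⟩
      rw [if_pos hTa, realize_and, realize_setEmpty v σ S hS,
        realize_ordPin v iW_ne_iA a (hT a (hTa ▸ Finset.mem_singleton_self a)), ha]
      exact ⟨hS0, rfl⟩

/-! ## §C The Held–Karp formulas -/

/-- **The Held–Karp formula** `phi μ T β σ` (fuel `μ`): "some duplicate-free path of `Gr x` runs
from `A` to `B_β` and has vertex set exactly `T ∪ S_σ`", written with the seven variables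
`A, B₀, B₁, S₀, S₁, V, W` by the recursion `P(U,a,b) = ⋁_c [E(c,b) ∧ P(U∖b, a, c)]` — the end
vertex alternates between `B₀, B₁`, the free set between `S₀, S₁`, the ordered part `T` of the
vertex set is carried in the INDEX of the formula. [folklore] -/
def phi : ℕ → Finset (Fin m) → Fin 2 → Fin 2 → CFormula powLang 7
  | 0, T, β, σ => base T β σ
  | μ + 1, T, β, σ =>
    (base T β σ).or
      ((CFormula.disj ((T.sort (· ≤ ·)).map fun t : Fin m =>
          .and (ordPin (t : ℕ) (iB β)) (exF (iB β.rev) (.and (edgeF (iB β.rev) (iB β))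
            (.and (inU (T.erase t) σ (iB β.rev)) (phi μ (T.erase t) β.rev σ)))))).or
        (.and (memF (iB β) (iS σ)) (exF (iS σ.rev) (.and (isDiffF σ.rev σ β)
          (exF (iB β.rev) (.and (edgeF (iB β.rev) (iB β))
            (.and (inU T σ.rev (iB β.rev)) (phi μ T β.rev σ.rev))))))))

/-- The erasure of a free set is a free set. [folklore] -/
def FreeSets.erase (S : FreeSets m g) (b : Fin m) : FreeSets m g :=
  ⟨S.1.erase b, fun i hi => S.2 i (Finset.mem_of_mem_erase hi)⟩

/-- Semantics of the ordered step, relative to an oracle for the recursive call. [folklore] -/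
theorem realize_ordStep (μ : ℕ) (T : Finset (Fin m)) (hT : ∀ t ∈ T, (t : ℕ) + g < m) (β σ : Fin 2)
    (S : FreeSets m g) (a b : Fin m) (ha : v iA = vtx a) (hb : v (iB β) = vtx b)
    (hS : v (iS σ) = fset S)
    (IH : ∀ (T' : Finset (Fin m)) (c : Fin m) (v' : Fin 7 → PowCarrier m g x), T' ⊆ T →
      T'.card < T.card → v' iA = vtx a → v' (iB β.rev) = vtx c → v' (iS σ) = fset S →
      ((phi μ T' β.rev σ).Realize v' ↔ HKSpec (Gr m x).Adj (T' ∪ S.1) a c)) :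
    (CFormula.disj ((T.sort (· ≤ ·)).map fun t : Fin m =>
        .and (ordPin (t : ℕ) (iB β)) (exF (iB β.rev) (.and (edgeF (iB β.rev) (iB β))
          (.and (inU (T.erase t) σ (iB β.rev)) (phi μ (T.erase t) β.rev σ)))))).Realize v ↔
      b ∈ T ∧ ∃ c ∈ (T.erase b) ∪ S.1, (Gr m x).Adj c b ∧
        HKSpec (Gr m x).Adj ((T.erase b) ∪ S.1) a c := by
  rw [CFormula.realize_disj]
  simp only [List.mem_map, Finset.mem_sort]
  have hTe : ∀ t, ∀ t' ∈ T.erase t, (t' : ℕ) + g < m :=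
    fun t t' ht' => hT t' (Finset.mem_of_mem_erase ht')
  have hupd : ∀ c : Fin m, Function.update v (iB β.rev) (vtx c) (iS σ) = fset S := fun c => by
    rw [Function.update_of_ne (iB_ne_iS _ _).symm, hS]
  have hupdA : ∀ c : Fin m, Function.update v (iB β.rev) (vtx c) iA = vtx a := fun c => by
    rw [Function.update_of_ne (iA_ne_iB _), ha]
  have key : ∀ t ∈ T, ((CFormula.and (ordPin (t : ℕ) (iB β)) (exF (iB β.rev)
      (.and (edgeF (iB β.rev) (iB β))
      (.and (inU (T.erase t) σ (iB β.rev)) (phi μ (T.erase t) β.rev σ))))).Realize v ↔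
      (b = t ∧ ∃ c ∈ (T.erase t) ∪ S.1, (Gr m x).Adj c b ∧
        HKSpec (Gr m x).Adj ((T.erase t) ∪ S.1) a c)) := by
    intro t ht
    rw [realize_and, realize_ordPin v (iW_ne_iB β) t (hT t ht), hb, vtx_inj, realize_exF]
    refine and_congr_right fun _ => ?_
    constructor
    · rintro ⟨z, hz⟩
      rw [realize_and, realize_and, realize_edgeF] at hz
      obtain ⟨⟨c, b', hc, hb', hadj⟩, hin, hphi⟩ := hz
      rw [Function.update_self] at hc
      rw [Function.update_of_ne (iB_rev_ne β).symm, hb, vtx_inj] at hb'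
      subst hb'
      subst hc
      rw [realize_inU _ (iW_ne_iB _) (T.erase t) (hTe t) σ S (hupd c), Function.update_self] at hin
      obtain ⟨u, hu, hmem⟩ := hin
      rw [vtx_inj] at hu
      subst hu
      refine ⟨c, hmem, hadj, ?_⟩
      exact (IH (T.erase t) c _ (Finset.erase_subset t T) (Finset.card_erase_lt_of_mem ht)
        (hupdA c) (Function.update_self ..) (hupd c)).1 hphi
    · rintro ⟨c, hmem, hadj, hspec⟩
      refine ⟨vtx c, ?_⟩
      rw [realize_and, realize_and, realize_edgeF]
      refine ⟨⟨c, b, Function.update_self .., ?_, hadj⟩, ?_, ?_⟩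
      · rw [Function.update_of_ne (iB_rev_ne β).symm, hb]
      · rw [realize_inU _ (iW_ne_iB _) (T.erase t) (hTe t) σ S (hupd c), Function.update_self]
        exact ⟨c, rfl, hmem⟩
      · exact (IH (T.erase t) c _ (Finset.erase_subset t T) (Finset.card_erase_lt_of_mem ht)
          (hupdA c) (Function.update_self ..) (hupd c)).2 hspec
  constructor
  · rintro ⟨φ, ⟨t, ht, rfl⟩, hφ⟩
    obtain ⟨rfl, hrest⟩ := (key t ht).1 hφ
    exact ⟨ht, hrest⟩
  · rintro ⟨hbT, hrest⟩
    exact ⟨_, ⟨b, hbT, rfl⟩, (key b hbT).2 ⟨rfl, hrest⟩⟩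

/-- Semantics of the free step, relative to an oracle for the recursive call. [folklore] -/
theorem realize_freeStep (μ : ℕ) (T : Finset (Fin m)) (hT : ∀ t ∈ T, (t : ℕ) + g < m) (β σ : Fin 2)
    (S : FreeSets m g) (a b : Fin m) (ha : v iA = vtx a) (hb : v (iB β) = vtx b)
    (hS : v (iS σ) = fset S)
    (IH : ∀ (c : Fin m) (v' : Fin 7 → PowCarrier m g x), b ∈ S.1 →
      v' iA = vtx a → v' (iB β.rev) = vtx c → v' (iS σ.rev) = fset (S.erase b) →
      ((phi μ T β.rev σ.rev).Realize v' ↔ HKSpec (Gr m x).Adj (T ∪ (S.erase b).1) a c)) :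
    (CFormula.and (memF (iB β) (iS σ)) (exF (iS σ.rev) (.and (isDiffF σ.rev σ β)
        (exF (iB β.rev) (.and (edgeF (iB β.rev) (iB β))
          (.and (inU T σ.rev (iB β.rev)) (phi μ T β.rev σ.rev))))))).Realize v ↔
      b ∈ S.1 ∧ ∃ c ∈ T ∪ S.1.erase b, (Gr m x).Adj c b ∧
        HKSpec (Gr m x).Adj (T ∪ S.1.erase b) a c := by
  rw [realize_and, realize_memF, exists_vtx_fset_iff S hS, hb]
  have hbS : (∃ u, vtx b = (vtx u : PowCarrier m g x) ∧ u ∈ S.1) ↔ b ∈ S.1 := by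
    constructor
    · rintro ⟨u, hu, huS⟩
      rw [vtx_inj] at hu
      exact hu ▸ huS
    · exact fun h => ⟨b, rfl, h⟩
  rw [hbS]
  refine and_congr_right fun hbmem => ?_
  rw [realize_exF]
  -- notation for the two successive updates
  have h1S : ∀ zS : PowCarrier m g x, Function.update v (iS σ.rev) zS (iS σ) = fset S := fun zS => by
    rw [Function.update_of_ne (iS_rev_ne σ).symm, hS]
  have h1B : ∀ zS : PowCarrier m g x, Function.update v (iS σ.rev) zS (iB β) = vtx b := fun zS => by
    rw [Function.update_of_ne (iB_ne_iS _ _), hb]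
  have h1A : ∀ zS : PowCarrier m g x, Function.update v (iS σ.rev) zS iA = vtx a := fun zS => by
    rw [Function.update_of_ne (iA_ne_iS _), ha]
  constructor
  · rintro ⟨zS, hz⟩
    rw [realize_and, realize_isDiffF _ σ.rev σ β S b (h1S zS) (h1B zS), Function.update_self,
      realize_exF] at hz
    obtain ⟨⟨S', rfl, hS'⟩, zc, hzc⟩ := hz
    have hS'e : S' = S.erase b := Subtype.ext hS'
    subst hS'e
    rw [realize_and, realize_and, realize_edgeF] at hzc
    obtain ⟨⟨c, b', hc, hb', hadj⟩, hin, hphi⟩ := hzc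
    rw [Function.update_self] at hc
    rw [Function.update_of_ne (iB_rev_ne β).symm, h1B] at hb'
    rw [vtx_inj] at hb'
    subst hb'
    subst hc
    have h2S : Function.update (Function.update v (iS σ.rev) (fset (S.erase b))) (iB β.rev) (vtx c)
        (iS σ.rev) = fset (S.erase b) := by
      rw [Function.update_of_ne (iB_ne_iS _ _).symm, Function.update_self]
    rw [realize_inU _ (iW_ne_iB _) T hT σ.rev (S.erase b) h2S, Function.update_self] at hin
    obtain ⟨u, hu, hmem⟩ := hin
    rw [vtx_inj] at hu
    subst hu
    refine ⟨c, hmem, hadj, ?_⟩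
    refine (IH c _ hbmem ?_ (Function.update_self ..) h2S).1 hphi
    rw [Function.update_of_ne (iA_ne_iB _), h1A]
  · rintro ⟨c, hmem, hadj, hspec⟩
    refine ⟨fset (S.erase b), ?_⟩
    rw [realize_and, realize_isDiffF _ σ.rev σ β S b (h1S _) (h1B _), Function.update_self,
      realize_exF]
    refine ⟨⟨S.erase b, rfl, rfl⟩, vtx c, ?_⟩
    have h2S : Function.update (Function.update v (iS σ.rev) (fset (S.erase b))) (iB β.rev) (vtx c)
        (iS σ.rev) = fset (S.erase b) := by
      rw [Function.update_of_ne (iB_ne_iS _ _).symm, Function.update_self]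
    rw [realize_and, realize_and, realize_edgeF]
    refine ⟨⟨c, b, Function.update_self .., ?_, hadj⟩, ?_, ?_⟩
    · rw [Function.update_of_ne (iB_rev_ne β).symm, h1B]
    · rw [realize_inU _ (iW_ne_iB _) T hT σ.rev (S.erase b) h2S, Function.update_self]
      exact ⟨c, rfl, hmem⟩
    · refine (IH c _ hbmem ?_ (Function.update_self ..) h2S).2 hspec
      rw [Function.update_of_ne (iA_ne_iB _), h1A]

end Formulas

/-! ### The Held–Karp recursion on `T ∪ S` -/

section Recursion

variable {V : Type*} [DecidableEq V] {R : V → V → Prop}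

/-- `(T ∪ S) ∖ b` when `b ∈ T` and `b ∉ S`. [folklore] -/
theorem erase_union_left {T S : Finset V} {b : V} (hbS : b ∉ S) :
    (T ∪ S).erase b = T.erase b ∪ S := by
  ext u
  simp only [Finset.mem_erase, Finset.mem_union]
  constructor
  · rintro ⟨hub, hu | hu⟩
    · exact Or.inl ⟨hub, hu⟩
    · exact Or.inr hu
  · rintro (⟨hub, hu⟩ | hu)
    · exact ⟨hub, Or.inl hu⟩
    · exact ⟨fun h => hbS (h ▸ hu), Or.inr hu⟩

/-- `(T ∪ S) ∖ b` when `b ∈ S` and `b ∉ T`. [folklore] -/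
theorem erase_union_right {T S : Finset V} {b : V} (hbT : b ∉ T) :
    (T ∪ S).erase b = T ∪ S.erase b := by
  rw [Finset.union_comm, erase_union_left hbT, Finset.union_comm]

/-- A duplicate-free chain on at most one vertex. [folklore] -/
theorem hkSpec_of_card_le_one {U : Finset V} {a b : V} (hU : U.card ≤ 1) :
    HKSpec R U a b ↔ (b = a ∧ U = {a}) := by
  constructor
  · intro h
    have hUa : U = {a} :=
      Finset.eq_singleton_iff_unique_mem.2 ⟨h.left_mem, fun u hu => Finset.card_le_one.1 hU u hu a h.left_mem⟩
    rw [hUa] at h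
    exact ⟨(hkSpec_singleton_iff a b).1 h, hUa⟩
  · rintro ⟨rfl, rfl⟩
    exact (hkSpec_singleton_iff b b).2 rfl

/-- **The Held–Karp recursion on a vertex set split as `T ∪ S`** (`T`, `S` disjoint): the path
either is the single vertex `a`, or ends at an element of `T`, or ends at an element of `S`. [folklore] -/
theorem hkSpec_union_iff {T S : Finset V} (hTS : Disjoint T S) (a b : V) :
    HKSpec R (T ∪ S) a b ↔
      (b = a ∧ T ∪ S = {a}) ∨
      (b ∈ T ∧ ∃ c ∈ T.erase b ∪ S, R c b ∧ HKSpec R (T.erase b ∪ S) a c) ∨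
      (b ∈ S ∧ ∃ c ∈ T ∪ S.erase b, R c b ∧ HKSpec R (T ∪ S.erase b) a c) := by
  by_cases hab : a = b
  · subst hab
    constructor
    · intro h
      left
      refine ⟨rfl, ?_⟩
      by_cases hc : (T ∪ S).card ≤ 1
      · exact ((hkSpec_of_card_le_one hc).1 h).2
      · exact absurd h (not_hkSpec_self (by omega))
    · rintro (⟨-, hU⟩ | ⟨haT, c, hc, -, hspec⟩ | ⟨haS, c, hc, -, hspec⟩)
      · rw [hU]
        exact (hkSpec_singleton_iff a a).2 rfl
      · have := hspec.left_mem
        rw [Finset.mem_union] at this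
        rcases this with h | h
        · exact absurd h (Finset.notMem_erase a T)
        · exact absurd h (Finset.disjoint_left.1 hTS haT)
      · have := hspec.left_mem
        rw [Finset.mem_union] at this
        rcases this with h | h
        · exact absurd haS (Finset.disjoint_left.1 hTS h)
        · exact absurd h (Finset.notMem_erase a S)
  · rw [hkSpec_step hab, Finset.mem_union]
    constructor
    · rintro ⟨hb | hb, c, hc, hR, hspec⟩
      · have hbS : b ∉ S := Finset.disjoint_left.1 hTS hb
        rw [erase_union_left hbS] at hc hspec
        exact Or.inr (Or.inl ⟨hb, c, hc, hR, hspec⟩)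
      · have hbT : b ∉ T := fun h => Finset.disjoint_left.1 hTS h hb
        rw [erase_union_right hbT] at hc hspec
        exact Or.inr (Or.inr ⟨hb, c, hc, hR, hspec⟩)
    · rintro (⟨hba, -⟩ | ⟨hb, c, hc, hR, hspec⟩ | ⟨hb, c, hc, hR, hspec⟩)
      · exact absurd hba.symm hab
      · have hbS : b ∉ S := Finset.disjoint_left.1 hTS hb
        rw [← erase_union_left hbS] at hc hspec
        exact ⟨Or.inl hb, c, hc, hR, hspec⟩
      · have hbT : b ∉ T := fun h => Finset.disjoint_left.1 hTS h hb
        rw [← erase_union_right hbT] at hc hspec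
        exact ⟨Or.inr hb, c, hc, hR, hspec⟩

end Recursion

/-! ### The semantic theorem -/

section Semantics

variable {m g : ℕ} {x : Fin m × Fin m → Bool}

/-- Ordered and free parts are disjoint. [folklore] -/
theorem disjoint_of_ordered {T : Finset (Fin m)} (hT : ∀ t ∈ T, (t : ℕ) + g < m) (S : FreeSets m g) :
    Disjoint T S.1 :=
  Finset.disjoint_left.2 fun _ huT huS => not_mem_of_ordered hT S huS huT

/-- **The Held–Karp formulas define the Held–Karp table.** With fuel `μ ≥ |T| + |S| - 1`, start
vertex `a` at `A`, end vertex `b` at `B_β` and free set `S` at `S_σ`, the formula `phi μ T β σ`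
holds in the powerset expansion of `x` iff some duplicate-free path of `Gr x` runs from `a` to `b`
with vertex set exactly `T ∪ S`. [Held–Karp 1962 (the recursion); folklore] [folklore] -/
theorem realize_phi : ∀ (μ : ℕ) (T : Finset (Fin m)) (β σ : Fin 2) (S : FreeSets m g) (a b : Fin m)
    (v : Fin 7 → PowCarrier m g x), (∀ t ∈ T, (t : ℕ) + g < m) → T.card + S.1.card ≤ μ + 1 →
    v iA = vtx a → v (iB β) = vtx b → v (iS σ) = fset S →
    ((phi μ T β σ).Realize v ↔ HKSpec (Gr m x).Adj (T ∪ S.1) a b) := by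
  intro μ
  induction μ with
  | zero =>
    intro T β σ S a b v hT hcard ha hb hS
    show (base T β σ).Realize v ↔ _
    rw [realize_base v T hT β σ S a b ha hb hS,
      hkSpec_of_card_le_one ((Finset.card_union_le _ _).trans (by omega))]
  | succ μ ih =>
    intro T β σ S a b v hT hcard ha hb hS
    have IH1 : ∀ (T' : Finset (Fin m)) (c : Fin m) (v' : Fin 7 → PowCarrier m g x), T' ⊆ T →
        T'.card < T.card → v' iA = vtx a → v' (iB β.rev) = vtx c → v' (iS σ) = fset S →
        ((phi μ T' β.rev σ).Realize v' ↔ HKSpec (Gr m x).Adj (T' ∪ S.1) a c) :=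
      fun T' c v' hT'T hlt ha' hc' hS' =>
        ih T' β.rev σ S a c v' (fun t ht => hT t (hT'T ht)) (by omega) ha' hc' hS'
    have IH2 : ∀ (c : Fin m) (v' : Fin 7 → PowCarrier m g x), b ∈ S.1 →
        v' iA = vtx a → v' (iB β.rev) = vtx c → v' (iS σ.rev) = fset (S.erase b) →
        ((phi μ T β.rev σ.rev).Realize v' ↔ HKSpec (Gr m x).Adj (T ∪ (S.erase b).1) a c) :=
      fun c v' hbS ha' hc' hS' => by
        have hce : (S.1.erase b).card + 1 = S.1.card := Finset.card_erase_add_one hbS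
        exact ih T β.rev σ.rev (S.erase b) a c v' hT
          (by show T.card + (S.1.erase b).card ≤ μ + 1; omega) ha' hc' hS'
    show ((base T β σ).or (CFormula.or _ _)).Realize v ↔ _
    rw [CFormula.realize_or, CFormula.realize_or, realize_base v T hT β σ S a b ha hb hS,
      realize_ordStep v μ T hT β σ S a b ha hb hS IH1, realize_freeStep v μ T hT β σ S a b ha hb hS IH2,
      hkSpec_union_iff (disjoint_of_ordered hT S) a b]

/-! ### Hamiltonicity as a `C^7` sentence -/

variable (m g)

/-- The ordered part as a vertex set. [folklore] -/
def ordPart : Finset (Fin m) := Finset.univ.filter fun i => (i : ℕ) + g < m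

/-- The full free set. [folklore] -/
def fullFree : FreeSets m g :=
  ⟨Finset.univ.filter fun i => IsFree m g i, fun _ hi => (Finset.mem_filter.1 hi).2⟩

/-- `S_σ` is the FULL free set. [folklore] -/
def isFullSet (σ : Fin 2) : CFormula powLang 7 :=
  .and (.not (vertF (iS σ))) (allF iV (iffF (memF iV (iS σ)) (exF iW (memF iV iW))))

/-- **Hamiltonicity as a sentence of `C^7` over the powerset expansion**: "for some `a ≠ b` with
`E(b,a)` the Held–Karp formula holds for the vertex set `Ord ∪ F`". [folklore] -/
def hamSentence : CFormula powLang 7 :=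
  exF iA (exF (iB 0) (.and (.not (.equal iA (iB 0))) (.and (edgeF (iB 0) iA)
    (exF (iS 0) (.and (isFullSet 0) (phi m (ordPart m g) 0 0))))))

variable {m g}

/-- Membership in the ordered part. [folklore] -/
theorem mem_ordPart {i : Fin m} : i ∈ ordPart m g ↔ (i : ℕ) + g < m := by simp [ordPart]

/-- Ordered and free vertices together are all vertices. [folklore] -/
theorem ordPart_union_fullFree : ordPart m g ∪ (fullFree m g).1 = Finset.univ := by
  ext i
  simp only [ordPart, fullFree, IsFree, Finset.mem_union, Finset.mem_filter, Finset.mem_univ, true_and,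
    iff_true]
  omega

/-- `|Ord| + |F| = m`. [folklore] -/
theorem card_ordPart_add : (ordPart m g).card + (fullFree m g).1.card = m := by
  have h := Finset.card_union_of_disjoint (disjoint_of_ordered (fun t ht => mem_ordPart.1 ht) (fullFree m g))
  rw [ordPart_union_fullFree, Finset.card_univ, Fintype.card_fin] at h
  exact h.symm

/-- Semantics of `isFullSet`. [folklore] -/
theorem realize_isFullSet (v : Fin 7 → PowCarrier m g x) (σ : Fin 2) :
    (isFullSet σ).Realize v ↔ v (iS σ) = fset (fullFree m g) := by
  show (¬ (vertF (iS σ)).Realize v ∧ (allF iV (iffF (memF iV (iS σ)) (exF iW (memF iV iW)))).Realize v) ↔ _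
  rw [realize_vertF, realize_allF]
  have inner : ∀ z : PowCarrier m g x, (iffF (memF iV (iS σ)) (exF iW (memF iV iW))).Realize
      (Function.update v iV z) ↔
      ((∃ (u : Fin m) (S' : FreeSets m g), z = vtx u ∧ v (iS σ) = fset S' ∧ u ∈ S'.1) ↔
        ∃ u, z = vtx u ∧ IsFree m g u) := by
    intro z
    rw [realize_iffF, realize_memF, realize_exF_memF _ iW_ne_iV]
    simp only [Function.update_self, Function.update_of_ne (iS_ne_iV _)]
  simp only [inner]
  constructor
  · rintro ⟨hnv, hall⟩
    rcases vtx_or_fset (v (iS σ)) with ⟨u, hu⟩ | ⟨S', hS'⟩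
    · exact absurd ⟨u, hu⟩ hnv
    rw [hS', fset_inj]
    apply Subtype.ext
    ext u
    have hu := hall (vtx u)
    rw [exists_vtx_fset_iff S' hS'] at hu
    simp only [vtx_inj, exists_eq_left'] at hu
    simp only [fullFree, Finset.mem_filter, Finset.mem_univ, true_and]
    exact hu
  · intro hS
    refine ⟨fun ⟨u, hu⟩ => absurd (hS.symm.trans hu) fset_ne_vtx, fun z => ?_⟩
    rw [exists_vtx_fset_iff _ hS]
    simp only [fullFree, Finset.mem_filter, Finset.mem_univ, true_and]

/-- Small graphs: on fewer than three vertices Hamiltonicity does not depend on the edges. [folklore] -/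
theorem isHamiltonian_iff_of_lt_three {V : Type*} [Fintype V] [DecidableEq V] (G : SimpleGraph V)
    (h3 : Fintype.card V < 3) : G.IsHamiltonian ↔ Fintype.card V = 1 := by
  rw [Literature.Combinatorics.SimpleGraph.isHamiltonian_iff_exists_isHamCycleListing]
  constructor
  · rintro (h | ⟨l, hl, hL⟩)
    · exact h
    · have := hL.length_eq
      omega
  · exact Or.inl

/-- **Semantics of the Hamiltonicity sentence** (`m ≥ 3`). [folklore] -/
theorem realize_hamSentence (hm : 3 ≤ m) (v : Fin 7 → PowCarrier m g x) :
    (hamSentence m g).Realize v ↔ (Gr m x).IsHamiltonian := by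
  have hcard : 3 ≤ Fintype.card (Fin m) := by simpa using hm
  rw [isHamiltonian_iff_hkSpec _ hcard]
  unfold hamSentence
  rw [realize_exF]
  constructor
  · rintro ⟨za, hza⟩
    rw [realize_exF] at hza
    obtain ⟨zb, hzb⟩ := hza
    rw [realize_and, realize_and, realize_not, realize_equal, realize_edgeF, realize_exF] at hzb
    obtain ⟨hne, ⟨b, a, hb, ha, hadj⟩, zS, hzS⟩ := hzb
    rw [Function.update_self] at hb
    rw [Function.update_of_ne (iA_ne_iB 0), Function.update_self] at ha
    rw [realize_and, realize_isFullSet, Function.update_self] at hzS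
    obtain ⟨rfl, hphi⟩ := hzS
    have hab : a ≠ b := by
      rintro rfl
      apply hne
      rw [Function.update_of_ne (iA_ne_iB 0), Function.update_self, Function.update_self, ha, hb]
    refine ⟨a, b, hab, hadj, ?_⟩
    rw [← ordPart_union_fullFree]
    refine (realize_phi m (ordPart m g) 0 0 (fullFree m g) a b _ (fun t ht => mem_ordPart.1 ht)
      (by rw [card_ordPart_add]; omega) ?_ ?_ (Function.update_self ..)).1 hphi
    · rw [Function.update_of_ne (iA_ne_iS 0), Function.update_of_ne (iA_ne_iB 0),
        Function.update_self, ha]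
    · rw [Function.update_of_ne (iB_ne_iS 0 0), Function.update_self, hb]
  · rintro ⟨a, b, hab, hadj, hspec⟩
    refine ⟨vtx a, ?_⟩
    rw [realize_exF]
    refine ⟨vtx b, ?_⟩
    rw [realize_and, realize_and, realize_not, realize_equal, realize_edgeF, realize_exF]
    refine ⟨?_, ⟨b, a, Function.update_self .., ?_, hadj⟩, fset (fullFree m g), ?_⟩
    · rw [Function.update_of_ne (iA_ne_iB 0), Function.update_self, Function.update_self, vtx_inj]
      exact hab
    · rw [Function.update_of_ne (iA_ne_iB 0), Function.update_self]
    · rw [realize_and, realize_isFullSet, Function.update_self]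
      refine ⟨rfl, ?_⟩
      rw [← ordPart_union_fullFree] at hspec
      refine (realize_phi m (ordPart m g) 0 0 (fullFree m g) a b _ (fun t ht => mem_ordPart.1 ht)
        (by rw [card_ordPart_add]; omega) ?_ ?_ (Function.update_self ..)).2 hspec
      · rw [Function.update_of_ne (iA_ne_iS 0), Function.update_of_ne (iA_ne_iB 0),
          Function.update_self]
      · rw [Function.update_of_ne (iB_ne_iS 0 0), Function.update_self]

end Semantics

/-! ## §D Hamiltonicity is `C^k`-invariant over the powerset expansion (`k ≥ 7`) -/

/-- **Held–Karp definability theorem.** If the powerset expansions of two `m × m` matrices at the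
same budget `g` are `C^k`-equivalent (bijective `k`-pebble game, `StructCkEquiv`) for some
`k ≥ 7`, the decoded graphs are simultaneously Hamiltonian or not — for EVERY `m` and `g`, with no
hypothesis on sizes, orbits or supports. (Held–Karp over the subsets of the free part is a
seven-variable definition of Hamiltonicity over the expansion, `hamSentence`; the transfer is
Hella's theorem, game ⇒ logic.) [Held–Karp 1962; Hella 1996; Cai–Fürer–Immerman 1992, Thm 5.2]
[folklore] -/
theorem isHamiltonian_iff_of_structCkEquiv {m g k : ℕ} (hk : 7 ≤ k) {x y : Fin m × Fin m → Bool}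
    (h : StructCkEquiv powLang k (PowCarrier m g x) (PowCarrier m g y)) :
    (Gr m x).IsHamiltonian ↔ (Gr m y).IsHamiltonian := by
  by_cases hm : 3 ≤ m
  · obtain ⟨S, hS⟩ := h.mono hk
    obtain ⟨v, w, hvw⟩ := S.exists_ofFun_mem fun _ => fset (fullFree m g)
    rw [← realize_hamSentence hm v, ← realize_hamSentence hm w]
    exact S.realize_iff_of_ofFun_mem hS _ v w hvw
  · have h3 : Fintype.card (Fin m) < 3 := by simp; omega
    rw [isHamiltonian_iff_of_lt_three _ h3, isHamiltonian_iff_of_lt_three _ h3]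





end Literature.ModelTheory.FiniteModelTheory.PowersetHK
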